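import Summits.QuantumFields.YangMills.Theorems.FluctuationComparisonRegPrIntLTailSupOneFibreRows
import Summits.QuantumFields.YangMills.Theorems.FluctuationComparisonRegPrIntLWregGlue
import Summits.QuantumFields.YangMills.Theorems.BalabanUVNodesN14ConvexFibreBox
import HarnessLib

/-!
# `FluctuationComparisonRegPrIntLTailSupOneChartRows` — LINE g21-2 «DEPTH-ONE WINDOW ODDS BY A MEASURE SPLIT»: THE CHART-NATIVE EDITION OF THE FIBRE ROWS
# (MOD₁∘ ∕ FPT-shaped measure rows FROM A `WindowChart`, i.e. from the push-forward identity `map_Φ` and the fibre identity `descendTo_Φ`, instead of `condLaw`)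
# (crux `UnitScaleTilt.FluctuationComparisonRegPrIntL`, stmt-QuantumFields-20520; rows of `Cruxes/…/Lines/tailsup_one.lean`, ideator ym-r3-idea-1 g21)

Cell `ym3-torus` (YM ladder rung R3 = continuum SU(2) Yang–Mills on T³ — a RUNG, NOT the Clay problem: not d = 4, not infinite volume, not a mass gap);
width seat `ym3-torus-px20` (gen 10); helper `--supports stmt-QuantumFields-20520`.  THEOREMS ONLY (0 `def`, 0 `sorry`, default heartbeats).

WHY.  The fibre-row door ✓`…TailSupOneFibreRows.gibbsK_restrict_map_le_of_fibrewise` (E §2) and its consumers (G comparison door, H∕I far side) speak the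
CONDITIONAL LAW `condLaw (fieldMeasure K) (descendTo J K) V` of lit `T4AveragingDisintegration`.  The tree's CHART suppliers — the WREG glue's posited interface
✓`…WregGlue.WindowChart F hJK Sfine O` (fields `Φ`, `jac`, `map_Φ : μ_K⌊(D⁻¹O ∩ Sfine) = Φ_*((μ_J⌊O ⊗ μ_K)·jac)`, `descendTo_Φ : jac ≠ 0 → D(Φ(V,z)) = V`), inhabited
by ✓`WindowChartsExist`-type theorems and the EXW∕CHART∞ lineage (`exists_laplaceRows₂`) — speak FIBRED CHARTS.  This file lets a MOD₁∘∕FPT hand that holds a chart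
plug the chart's FIBRE INTEGRAL `V ↦ ∫ 1_T(Φ(V,z))·e^{−β_K A(Φ(V,z))}·jac(V,z) dμ_K(z)` straight into the row, with no disintegration-uniqueness lemma in between,
and patches LOCAL charts (one open `O ∋ V₀` per window datum) into the row on the whole window.
* §1 ★`restrict_le_smul_restrict_of_locally` — GENERIC (second-countable `α`, open sets measurable, `W` measurable): if every `V ∈ W` has an open `O ∋ V` with
  `μ₁⌊(O ∩ W) ≤ c • μ₂⌊(O ∩ W)`, then `μ₁⌊W ≤ c • μ₂⌊W` (countable subcover `TopologicalSpace.countable_cover_nhdsWithin` + `disjointed` + `measure_iUnion`).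
* §2 ★★`setLIntegral_preimage_inter_eq_of_fibredChart` — GENERIC fibred chart `(μ, τ, Φ, J)` of `avg` over `U` on `S` in lit `Node00`'s SUPPORT FORM
  (`hmap : ν⌊(avg⁻¹U ∩ S) = Φ_*((μ⌊U ⊗ τ)·J)`, `havgΦJ : J(V,z) ≠ 0 → avg(Φ(V,z)) = V`): for measurable `T ⊆ S`, `B ⊆ U` and a measurable weight `w`,
  `∫⁻_{avg⁻¹B ∩ T} w dν = ∫⁻_{V ∈ B} ∫⁻_z 1_T(Φ(V,z))·w(Φ(V,z))·J(V,z) dτ dμ` — the `∫⁻` twin of ✓`Node00.integral_mul_comp_eq_integral_fibreIntegral_mul_of_ne_zero`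
  and the chart twin of ✓C `withDensity_preimage_inter_eq_lintegral_condLaw`; ★`setwise_of_chartwise` — an a.e.-on-`U` comparison of the two fibre integrals
  (`T := E` vs `T := G`) gives `(ν·w)(avg⁻¹B ∩ E) ≤ c·(ν·w)(avg⁻¹B ∩ G)` for every measurable `B ⊆ U`.
* §3 THE RUNS ★★★`gibbsK_restrict_map_le_of_chartwise (c : WindowChart F hJK Sfine O)` — `E, G ⊆ Sfine` measurable, `O` open, and for `μ_J`-a.e. `V ∈ O`:
  `∫⁻ 1_E(c.Φ(V,z))·e^{−β_K A}(c.Φ(V,z))·c.jac(V,z) dμ_K ≤ ofReal σ · ∫⁻ 1_G(…)·…` ⟹ `(D_*(Gibbs_K⌊E))⌊O ≤ ofReal σ • (D_*(Gibbs_K⌊G))⌊O` (✓E `restrict_map_le_smul_of_setwise`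
  ∘ §2 ∘ ✓`gibbsK_eq_smul_withDensity`); `…_inter` (the `O ∩ W` form); ★★`gibbsK_restrict_map_le_of_charts` — a chart with the comparison AT EVERY datum of an open
  window `W` ⟹ the row on `W` (§1) — MOD₁∘'s ∕ FPT's inequality VERBATIM at `W := {PlaqSmall (θBal …)}`, `G := histGood (J+1) J`.
* §4 (v1.1) ★★★`gibbsK_restrict_map_le_of_fibredChartwise` — §3 for ANY support-form fibred chart `(Z, τ, Φ, Jc)` of `D_{J,K}` (e.g. `τ` = Lebesgue on a chart domain of
  `ℝⁿ` after the exponential coordinates); §5 (v1.1) ★★`lintegral_indicator_chart_eq_mul_tilted` ∕ ★★★`comparison_rows_of_euclideanChart` — an exact Euclidean chart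
  of the moderate region (`w(Φ z)·Jc z = e^{−U z}` on `Ω`) turns the fibre integrals into `Z·ν(Φ⁻¹T)` with `ν = (volume.restrict Ω).tilted (−U)` (the law of F∕F-BOX)
  and delivers ✓G's (α)(β) with ONE constant `Z` — so E-CHART, G and F-BOX meet by name.
HONEST SCOPE.  Measure bookkeeping over landed definitions; the charts and the fibre-integral comparisons are the hands' content (MOD₁∘: Laplace on the moderate
region via F∕F-BOX∕F-η∕G; FPT: the deleted-plaquette bound via H∕I) and are NOT constructed here; MOD₁, MOD₁∘, FAR₁, FPT, TAILSUP₁, LFR♯ᶜ, S2β, 20520, `YM3TorusSU2`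
NOT proved; the Yang–Mills mass gap is NOT proved.
References: [Balaban1985Averaging] (10) p. 19 (the averaging push-forward); [Balaban1987RG1] (0.13) p. 254, (2.10) p. 267 (fibred charts of the averaging);
[Balaban1985UV3] (7) p. 257, (38)–(41) p. 266.
-/

noncomputable section

set_option autoImplicit false

open MeasureTheory ProbabilityTheory Filter Topology Set
open scoped ENNReal NNReal
open Literature.MathematicalPhysics.QuantumFieldTheory.Balaban1983to89
open Literature.MathematicalPhysics.QuantumFieldTheory.Balaban1983to89.T3ContinuumYM3Torus
open Literature.MathematicalPhysics.QuantumFieldTheory.Balaban1983to89.T3NestedUnitLaws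
open Literature.MathematicalPhysics.QuantumFieldTheory.Balaban1983to89.T3UnitLawDensityEML
open Literature.MathematicalPhysics.QuantumFieldTheory.Balaban1983to89.T3UnitScaleTilt
open Literature.MathematicalPhysics.QuantumFieldTheory.Balaban1983to89.T3TiltDescent
open Literature.MathematicalPhysics.QuantumFieldTheory.Balaban1983to89.Missing
open scoped Literature.MathematicalPhysics.QuantumFieldTheory.Balaban1983to89.T3OrbitAverage
open Summit.QuantumFields.YangMills.Theorems.FluctuationComparisonRegPrIntLSupTailFibreOdds (gibbsK_eq_smul_withDensity)
open Summit.QuantumFields.YangMills.Theorems.FluctuationComparisonRegPrIntLTailSupOneFibreRows (restrict_map_le_smul_of_setwise)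
open Summit.QuantumFields.YangMills.Theorems.FluctuationComparisonRegPrIntLWregGlue (WindowChart)

namespace Summit.QuantumFields.YangMills.Theorems.FluctuationComparisonRegPrIntLTailSupOneChartRows

/-! ## §1 Generic: a local measure domination on a second-countable space is global -/

section Local

variable {α : Type*} [TopologicalSpace α] [MeasurableSpace α] [OpensMeasurableSpace α] [SecondCountableTopology α]

/-- ★ **LOCAL-TO-GLOBAL DOMINATION**: if every point `V` of a measurable `W` has an open neighbourhood `O` with `μ₁⌊(O ∩ W) ≤ c • μ₂⌊(O ∩ W)`, then
`μ₁⌊W ≤ c • μ₂⌊W` (countable subcover of `W` by such `O`'s, disjointified; `σ`-additivity of `μ₁`, `μ₂`). [folklore] -/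
theorem restrict_le_smul_restrict_of_locally (μ₁ μ₂ : Measure α) {W : Set α} (hW : MeasurableSet W) {c : ℝ≥0∞}
    (h : ∀ V ∈ W, ∃ O : Set α, IsOpen O ∧ V ∈ O ∧ μ₁.restrict (O ∩ W) ≤ c • μ₂.restrict (O ∩ W)) :
    μ₁.restrict W ≤ c • μ₂.restrict W := by
  classical
  choose! O hOo hOV hOle using h
  -- a countable subcover of `W`
  obtain ⟨t, htW, htc, hcover⟩ : ∃ t ⊆ W, t.Countable ∧ W ⊆ ⋃ V ∈ t, O V :=
    TopologicalSpace.countable_cover_nhdsWithin fun V hV => mem_nhdsWithin_of_mem_nhds ((hOo V hV).mem_nhds (hOV V hV))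
  rcases Set.eq_empty_or_nonempty t with ht0 | htne
  · subst ht0
    have hW0 : W = ∅ := Set.subset_empty_iff.mp (by simpa using hcover)
    subst hW0
    simp
  -- enumerate `t` by `ℕ` and disjointify the cover
  obtain ⟨e, he⟩ : ∃ e : ℕ → α, t = Set.range e := htc.exists_eq_range htne
  have het : ∀ n, e n ∈ t := fun n => he ▸ Set.mem_range_self n
  have hQm : ∀ n, MeasurableSet (disjointed (fun n => O (e n)) n) :=
    MeasurableSet.disjointed fun n => (hOo (e n) (htW (het n))).measurableSet
  have hQcover : W ⊆ ⋃ n, disjointed (fun n => O (e n)) n := by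
    rw [iUnion_disjointed]
    intro V hV
    obtain ⟨x, hx, hVx⟩ := Set.mem_iUnion₂.mp (hcover hV)
    rw [he] at hx
    obtain ⟨n, rfl⟩ := hx
    exact Set.mem_iUnion.mpr ⟨n, hVx⟩
  refine Measure.le_iff.mpr fun A hA => ?_
  rw [Measure.restrict_apply hA, Measure.smul_apply, Measure.restrict_apply hA, smul_eq_mul]
  have hX : ∀ n, MeasurableSet (A ∩ W ∩ disjointed (fun n => O (e n)) n) := fun n => (hA.inter hW).inter (hQm n)
  have hAW : A ∩ W = ⋃ n, A ∩ W ∩ disjointed (fun n => O (e n)) n := by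
    rw [← Set.inter_iUnion]
    exact (Set.inter_eq_left.mpr (Set.inter_subset_right.trans hQcover)).symm
  have hdisj : Pairwise (Function.onFun Disjoint fun n => A ∩ W ∩ disjointed (fun n => O (e n)) n) :=
    fun i j hij => (disjoint_disjointed (fun n => O (e n)) hij).mono Set.inter_subset_right Set.inter_subset_right
  rw [hAW, measure_iUnion hdisj hX, measure_iUnion hdisj hX, ← ENNReal.tsum_mul_left]
  refine ENNReal.tsum_le_tsum fun n => ?_
  have hsub : A ∩ W ∩ disjointed (fun n => O (e n)) n ⊆ O (e n) ∩ W := fun V hV => ⟨disjointed_subset _ n hV.2, hV.1.2⟩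
  have h2 := (Measure.le_iff.mp (hOle (e n) (htW (het n)))) (A ∩ W ∩ disjointed (fun n => O (e n)) n) (hX n)
  rwa [Measure.restrict_apply (hX n), Measure.smul_apply, Measure.restrict_apply (hX n), smul_eq_mul,
    Set.inter_eq_left.mpr hsub] at h2

end Local

/-! ## §2 Generic: set masses through a fibred chart in support form -/

section FibredChart

variable {α β Z : Type*} [MeasurableSpace α] [MeasurableSpace β] [MeasurableSpace Z]
  {ν : Measure β} {μ : Measure α} {τ : Measure Z} {avg : β → α} {U : Set α} {S : Set β} {Φ : α × Z → β} {J : α × Z → ℝ≥0}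

/-- ★★ **THE MASS OF `avg⁻¹B ∩ T` THROUGH A FIBRED CHART** (support form of lit `Node00`: `hmap : ν⌊(avg⁻¹U ∩ S) = Φ_*((μ⌊U ⊗ τ)·J)`, `havgΦJ : J(V,z) ≠ 0 → avg(Φ(V,z)) = V`):
for measurable `T ⊆ S`, `B ⊆ U` and a measurable weight `w`, `∫⁻_{avg⁻¹B ∩ T} w dν = ∫⁻_{V ∈ B} ∫⁻_z 1_T(Φ(V,z))·w(Φ(V,z))·J(V,z) dτ dμ`
(`lintegral_map`, `withDensity`, Tonelli; the factor `J` makes the fibre identity needed only on its support). [cite: Balaban1987RG1, (2.10) p.267 and (0.13) p.254] -/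
theorem setLIntegral_preimage_inter_eq_of_fibredChart [SFinite μ] [SFinite τ] (hU : MeasurableSet U) (havg : Measurable avg)
    (hΦ : Measurable Φ) (hJ : Measurable J) (havgΦJ : ∀ V ∈ U, ∀ z, J (V, z) ≠ 0 → avg (Φ (V, z)) = V)
    (hmap : ν.restrict (avg ⁻¹' U ∩ S) = (((μ.restrict U).prod τ).withDensity (fun p => (J p : ℝ≥0∞))).map Φ)
    {w : β → ℝ≥0∞} (hw : Measurable w) {T : Set β} (hT : MeasurableSet T) (hTS : T ⊆ S) {B : Set α} (hB : MeasurableSet B) (hBU : B ⊆ U) :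
    ∫⁻ x in avg ⁻¹' B ∩ T, w x ∂ν = ∫⁻ V in B, (∫⁻ z, T.indicator w (Φ (V, z)) * J (V, z) ∂τ) ∂μ := by
  have hBT : MeasurableSet (avg ⁻¹' B ∩ T) := (havg hB).inter hT
  have hsub : avg ⁻¹' B ∩ T ⊆ avg ⁻¹' U ∩ S := fun x hx => ⟨hBU hx.1, hTS hx.2⟩
  -- move to the restricted measure, where the chart presentation holds
  have h1 : ∫⁻ x in avg ⁻¹' B ∩ T, w x ∂ν = ∫⁻ x, (avg ⁻¹' B ∩ T).indicator w x ∂(ν.restrict (avg ⁻¹' U ∩ S)) := by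
    rw [lintegral_indicator hBT, Measure.restrict_restrict hBT, Set.inter_eq_left.mpr hsub]
  have hind : Measurable ((avg ⁻¹' B ∩ T).indicator w) := hw.indicator hBT
  have hJ' : Measurable fun p : α × Z => (J p : ℝ≥0∞) := hJ.coe_nnreal_ennreal
  have hgΦ : Measurable fun a : α × Z => (avg ⁻¹' B ∩ T).indicator w (Φ a) := hind.comp hΦ
  rw [h1, hmap, lintegral_map hind hΦ, lintegral_withDensity_eq_lintegral_mul _ hJ' hgΦ,
    lintegral_prod _ (hJ'.mul hgΦ).aemeasurable]
  -- the inner integral is `1_B(V) · ∫⁻ 1_T(Φ) w(Φ) J dτ` on `U`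
  have hptw : ∀ V ∈ U,
      ∫⁻ z, ((fun p : α × Z => (J p : ℝ≥0∞)) * fun a : α × Z => (avg ⁻¹' B ∩ T).indicator w (Φ a)) (V, z) ∂τ =
        B.indicator (fun V => ∫⁻ z, T.indicator w (Φ (V, z)) * J (V, z) ∂τ) V := by
    intro V hVU
    by_cases hVB : V ∈ B
    · rw [Set.indicator_of_mem hVB]
      refine lintegral_congr fun z => ?_
      show (J (V, z) : ℝ≥0∞) * (avg ⁻¹' B ∩ T).indicator w (Φ (V, z)) = T.indicator w (Φ (V, z)) * J (V, z)
      by_cases hJ0 : J (V, z) = 0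
      · simp [hJ0]
      · have havgV : avg (Φ (V, z)) = V := havgΦJ V hVU z hJ0
        rw [mul_comm]
        congr 1
        by_cases hT' : Φ (V, z) ∈ T
        · have hmem : Φ (V, z) ∈ avg ⁻¹' B ∩ T := ⟨by rw [Set.mem_preimage, havgV]; exact hVB, hT'⟩
          rw [Set.indicator_of_mem hT', Set.indicator_of_mem hmem]
        · rw [Set.indicator_of_notMem hT', Set.indicator_of_notMem (fun h => hT' h.2)]
    · rw [Set.indicator_of_notMem hVB]
      have h0 : ∀ z, ((fun p : α × Z => (J p : ℝ≥0∞)) * fun a : α × Z => (avg ⁻¹' B ∩ T).indicator w (Φ a)) (V, z) = 0 := by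
        intro z
        show (J (V, z) : ℝ≥0∞) * (avg ⁻¹' B ∩ T).indicator w (Φ (V, z)) = 0
        by_cases hJ0 : J (V, z) = 0
        · simp [hJ0]
        · have havgV : avg (Φ (V, z)) = V := havgΦJ V hVU z hJ0
          have hnot : Φ (V, z) ∉ avg ⁻¹' B ∩ T := fun h => hVB (by
            have h' := h.1
            rwa [Set.mem_preimage, havgV] at h')
          rw [Set.indicator_of_notMem hnot, mul_zero]
      simp only [h0, lintegral_zero]
  rw [setLIntegral_congr_fun hU (fun V hV => hptw V hV), lintegral_indicator hB, Measure.restrict_restrict hB,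
    Set.inter_eq_left.mpr hBU]

/-- ★ **A CHARTWISE COMPARISON IS A SETWISE COMPARISON**: under the fibred chart of §2, measurable `E, G ⊆ S` and an a.e.-on-`U` comparison of the two fibre
integrals `∫⁻ 1_E(Φ)·w(Φ)·J dτ ≤ c·∫⁻ 1_G(Φ)·w(Φ)·J dτ` give `(ν·w)(avg⁻¹B ∩ E) ≤ c·(ν·w)(avg⁻¹B ∩ G)` for every measurable `B ⊆ U` — the hypothesis of
✓`…TailSupOneFibreRows.restrict_map_le_smul_of_setwise`. [cite: Balaban1987RG1, (2.10) p.267; Balaban1985Averaging, (10) p.19] -/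
theorem setwise_of_chartwise [SFinite μ] [SFinite τ] (hU : MeasurableSet U) (havg : Measurable avg)
    (hΦ : Measurable Φ) (hJ : Measurable J) (havgΦJ : ∀ V ∈ U, ∀ z, J (V, z) ≠ 0 → avg (Φ (V, z)) = V)
    (hmap : ν.restrict (avg ⁻¹' U ∩ S) = (((μ.restrict U).prod τ).withDensity (fun p => (J p : ℝ≥0∞))).map Φ)
    {w : β → ℝ≥0∞} (hw : Measurable w) {E G : Set β} (hE : MeasurableSet E) (hES : E ⊆ S) (hG : MeasurableSet G) (hGS : G ⊆ S)
    {c : ℝ≥0∞}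
    (hfib : ∀ᵐ V ∂μ, V ∈ U →
      ∫⁻ z, E.indicator w (Φ (V, z)) * J (V, z) ∂τ ≤ c * ∫⁻ z, G.indicator w (Φ (V, z)) * J (V, z) ∂τ) :
    ∀ B : Set α, MeasurableSet B → B ⊆ U → (ν.withDensity w) (avg ⁻¹' B ∩ E) ≤ c * (ν.withDensity w) (avg ⁻¹' B ∩ G) := by
  intro B hB hBU
  have hJ' : Measurable fun p : α × Z => (J p : ℝ≥0∞) := hJ.coe_nnreal_ennreal
  have hmeasG : Measurable fun V => ∫⁻ z, G.indicator w (Φ (V, z)) * J (V, z) ∂τ :=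
    (((hw.indicator hG).comp hΦ).mul hJ').lintegral_prod_right'
  rw [withDensity_apply _ ((havg hB).inter hE), withDensity_apply _ ((havg hB).inter hG),
    setLIntegral_preimage_inter_eq_of_fibredChart hU havg hΦ hJ havgΦJ hmap hw hE hES hB hBU,
    setLIntegral_preimage_inter_eq_of_fibredChart hU havg hΦ hJ havgΦJ hmap hw hG hGS hB hBU,
    ← lintegral_const_mul c hmeasG]
  exact setLIntegral_mono_ae' hB (by filter_upwards [hfib] with V hV hVB using hV (hBU hVB))

end FibredChart

/-! ## §3 The runs: MOD₁∘ ∕ FPT-shaped rows from a `WindowChart` -/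

section Runs

variable (F : T3Family) {γ : ℝ} {J K : ℕ} (hJK : J ≤ K)

/-- ★★★ **`(D_*(Gibbs_K⌊E))⌊O ≤ ofReal σ • (D_*(Gibbs_K⌊G))⌊O` ⟸ A CHARTWISE COMPARISON ON A WINDOW CHART**: `c : WindowChart F hJK Sfine O` (WREG glue's fibred chart of
`D_{J,K}` over the open `O` on `Sfine`), measurable `E, G ⊆ Sfine`, and for `μ_J`-a.e. `V ∈ O` the chart's Boltzmann-weighted fibre integrals compare:
`∫⁻ 1_E(c.Φ(V,z))·e^{−β_K A(c.Φ(V,z))}·c.jac(V,z) dμ_K(z) ≤ ofReal σ·∫⁻ 1_G(…)·… dμ_K(z)` ⟹ the descended restricted Gibbs measures satisfy the fibre-row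
inequality ON `O` (✓E `restrict_map_le_smul_of_setwise` ∘ §2 ∘ ✓`gibbsK_eq_smul_withDensity`) — the chart twin of ✓E `gibbsK_restrict_map_le_of_fibrewise`.
[cite: Balaban1985UV3, (7) p.257 and (38)-(41) p.266; Balaban1987RG1, (2.10) p.267] -/
theorem gibbsK_restrict_map_le_of_chartwise
    {Sfine : Set (GaugeField (F.P K) 0 (Matrix.specialUnitaryGroup (Fin 2) ℂ))} {O : Set (GaugeField (F.P J) 0 (Matrix.specialUnitaryGroup (Fin 2) ℂ))}
    (c : WindowChart F hJK Sfine O) (hO : IsOpen O)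
    {E G : Set (GaugeField (F.P K) 0 (Matrix.specialUnitaryGroup (Fin 2) ℂ))} (hE : MeasurableSet E) (hES : E ⊆ Sfine)
    (hG : MeasurableSet G) (hGS : G ⊆ Sfine) {σ : ℝ}
    (hfib : ∀ᵐ V ∂(fieldMeasure (F.P J) 0 (Matrix.specialUnitaryGroup (Fin 2) ℂ)), V ∈ O →
      ∫⁻ z, E.indicator (fun U => ENNReal.ofReal (boltzmann (F.P K) ((F.scheme ℰp γ).β K) U)) (c.Φ (V, z)) * (c.jac (V, z) : ℝ≥0∞)
          ∂(fieldMeasure (F.P K) 0 (Matrix.specialUnitaryGroup (Fin 2) ℂ)) ≤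
        ENNReal.ofReal σ *
          ∫⁻ z, G.indicator (fun U => ENNReal.ofReal (boltzmann (F.P K) ((F.scheme ℰp γ).β K) U)) (c.Φ (V, z)) * (c.jac (V, z) : ℝ≥0∞)
            ∂(fieldMeasure (F.P K) 0 (Matrix.specialUnitaryGroup (Fin 2) ℂ))) :
    (Measure.map (descendTo F ℰp J K hJK) ((gibbsK F ℰp γ K).restrict E)).restrict O ≤
      ENNReal.ofReal σ • (Measure.map (descendTo F ℰp J K hJK) ((gibbsK F ℰp γ K).restrict G)).restrict O := by
  haveI := isProbabilityMeasure_fieldMeasure (G := Matrix.specialUnitaryGroup (Fin 2) ℂ) (F.P J) 0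
  haveI := isProbabilityMeasure_fieldMeasure (G := Matrix.specialUnitaryGroup (Fin 2) ℂ) (F.P K) 0
  have hD : Measurable (descendTo F ℰp J K hJK) := measurable_descendTo F ℰp measurableE_ℰp hJK
  have hw : Measurable fun U : GaugeField (F.P K) 0 (Matrix.specialUnitaryGroup (Fin 2) ℂ) =>
      ENNReal.ofReal (boltzmann (F.P K) ((F.scheme ℰp γ).β K) U) := (measurable_boltzmann RegularGaugeGroup.measurable_reTr _ _).ennreal_ofReal
  refine restrict_map_le_smul_of_setwise (gibbsK F ℰp γ K) hD hO.measurableSet fun B hB hBO => ?_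
  have hset := setwise_of_chartwise hO.measurableSet hD c.measurable_Φ c.measurable_jac c.descendTo_Φ c.map_Φ hw hE hES hG hGS hfib B hB hBO
  rw [gibbsK_eq_smul_withDensity]
  simp only [Measure.smul_apply, smul_eq_mul]
  rw [mul_left_comm]
  exact mul_le_mul' le_rfl hset

/-- ★ **THE `O ∩ W` FORM**: the same conclusion restricted to `O ∩ W` for any set `W` (e.g. the window `{PlaqSmall (θBal …)}`) — the shape §1's local-to-global patch consumes.
[cite: Balaban1985UV3, (7) p.257] -/
theorem gibbsK_restrict_map_le_of_chartwise_inter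
    {Sfine : Set (GaugeField (F.P K) 0 (Matrix.specialUnitaryGroup (Fin 2) ℂ))} {O : Set (GaugeField (F.P J) 0 (Matrix.specialUnitaryGroup (Fin 2) ℂ))}
    (c : WindowChart F hJK Sfine O) (hO : IsOpen O)
    {E G : Set (GaugeField (F.P K) 0 (Matrix.specialUnitaryGroup (Fin 2) ℂ))} (hE : MeasurableSet E) (hES : E ⊆ Sfine)
    (hG : MeasurableSet G) (hGS : G ⊆ Sfine) {σ : ℝ}
    (hfib : ∀ᵐ V ∂(fieldMeasure (F.P J) 0 (Matrix.specialUnitaryGroup (Fin 2) ℂ)), V ∈ O →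
      ∫⁻ z, E.indicator (fun U => ENNReal.ofReal (boltzmann (F.P K) ((F.scheme ℰp γ).β K) U)) (c.Φ (V, z)) * (c.jac (V, z) : ℝ≥0∞)
          ∂(fieldMeasure (F.P K) 0 (Matrix.specialUnitaryGroup (Fin 2) ℂ)) ≤
        ENNReal.ofReal σ *
          ∫⁻ z, G.indicator (fun U => ENNReal.ofReal (boltzmann (F.P K) ((F.scheme ℰp γ).β K) U)) (c.Φ (V, z)) * (c.jac (V, z) : ℝ≥0∞)
            ∂(fieldMeasure (F.P K) 0 (Matrix.specialUnitaryGroup (Fin 2) ℂ)))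
    (W : Set (GaugeField (F.P J) 0 (Matrix.specialUnitaryGroup (Fin 2) ℂ))) (hW : MeasurableSet W) :
    (Measure.map (descendTo F ℰp J K hJK) ((gibbsK F ℰp γ K).restrict E)).restrict (O ∩ W) ≤
      ENNReal.ofReal σ • (Measure.map (descendTo F ℰp J K hJK) ((gibbsK F ℰp γ K).restrict G)).restrict (O ∩ W) := by
  have h := gibbsK_restrict_map_le_of_chartwise F hJK c hO hE hES hG hGS hfib
  have h2 := Measure.restrict_mono (le_refl W) h
  rw [Measure.restrict_restrict hW, Measure.restrict_smul, Measure.restrict_restrict hW, Set.inter_comm] at h2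
  exact h2

/-- ★★ **THE ROW ON THE WHOLE WINDOW FROM A CHART AT EVERY DATUM**: `W` open (e.g. `{PlaqSmall (θBal F.L γ (c·b₀) p₀ J)}`), measurable fine events `E, G`, and at every
`V₀ ∈ W` a window chart `c : WindowChart F hJK Sfine O` over an open `O ∋ V₀` with `E, G ⊆ Sfine` and the chartwise comparison a.e. on `O` ⟹
`(D_*(Gibbs_K⌊E))⌊W ≤ ofReal σ • (D_*(Gibbs_K⌊G))⌊W` — at `K = J+1`, `G = histGood (J+1) J`: MOD₁∘'s inequality (`E = histGoodᶜ ∩ {PlaqSmall δ₀}`, or the pinned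
event) ∕ FPT's (`E = {δ₀ ≤ dist1 U(∂p)}`) VERBATIM (§1 ∘ the `O ∩ W` form). [cite: Balaban1985UV3, (7) p.257 and (38)-(41) p.266; Balaban1987RG1, (2.10) p.267] -/
theorem gibbsK_restrict_map_le_of_charts {W : Set (GaugeField (F.P J) 0 (Matrix.specialUnitaryGroup (Fin 2) ℂ))} (hW : IsOpen W)
    {E G : Set (GaugeField (F.P K) 0 (Matrix.specialUnitaryGroup (Fin 2) ℂ))} (hE : MeasurableSet E) (hG : MeasurableSet G) {σ : ℝ}
    (h : ∀ V₀ ∈ W, ∃ (Sfine : Set (GaugeField (F.P K) 0 (Matrix.specialUnitaryGroup (Fin 2) ℂ)))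
        (O : Set (GaugeField (F.P J) 0 (Matrix.specialUnitaryGroup (Fin 2) ℂ))) (c : WindowChart F hJK Sfine O),
        IsOpen O ∧ V₀ ∈ O ∧ E ⊆ Sfine ∧ G ⊆ Sfine ∧
        ∀ᵐ V ∂(fieldMeasure (F.P J) 0 (Matrix.specialUnitaryGroup (Fin 2) ℂ)), V ∈ O →
          ∫⁻ z, E.indicator (fun U => ENNReal.ofReal (boltzmann (F.P K) ((F.scheme ℰp γ).β K) U)) (c.Φ (V, z)) * (c.jac (V, z) : ℝ≥0∞)
              ∂(fieldMeasure (F.P K) 0 (Matrix.specialUnitaryGroup (Fin 2) ℂ)) ≤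
            ENNReal.ofReal σ *
              ∫⁻ z, G.indicator (fun U => ENNReal.ofReal (boltzmann (F.P K) ((F.scheme ℰp γ).β K) U)) (c.Φ (V, z)) * (c.jac (V, z) : ℝ≥0∞)
                ∂(fieldMeasure (F.P K) 0 (Matrix.specialUnitaryGroup (Fin 2) ℂ))) :
    (Measure.map (descendTo F ℰp J K hJK) ((gibbsK F ℰp γ K).restrict E)).restrict W ≤
      ENNReal.ofReal σ • (Measure.map (descendTo F ℰp J K hJK) ((gibbsK F ℰp γ K).restrict G)).restrict W := by
  refine restrict_le_smul_restrict_of_locally _ _ hW.measurableSet fun V₀ hV₀ => ?_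
  obtain ⟨Sfine, O, c, hO, hV₀O, hES, hGS, hfib⟩ := h V₀ hV₀
  exact ⟨O, hO, hV₀O, gibbsK_restrict_map_le_of_chartwise_inter F hJK c hO hE hES hG hGS hfib W hW.measurableSet⟩

end Runs


/-! ## §4 (v1.1) ANY fibre coordinates: the row from a fibred chart of `D_{J,K}` in support form over an arbitrary s-finite `(Z, τ)` -/

section AnyFibre

variable (F : T3Family) {γ : ℝ} {J K : ℕ} (hJK : J ≤ K)

/-- ★★★ **THE ROW FROM A FIBRED CHART WITH ARBITRARY FIBRE COORDINATES** (v1.1): as `gibbsK_restrict_map_le_of_chartwise`, but the chart `(Z, τ, Φ, Jc)` of `D_{J,K}`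
over the open `O` on `Sfine` is ANY support-form fibred chart — `τ` any s-finite measure on any measurable `Z` (e.g. Lebesgue on a chart domain of `ℝⁿ`, after composing
the WREG∕Haar chart with the exponential coordinates; `Jc` then carries `|det jac| = Π sinc²` as well), `hmap : μ_K⌊(D⁻¹O ∩ Sfine) = Φ_*((μ_J⌊O ⊗ τ)·Jc)`,
`hDΦ : Jc(V,z) ≠ 0 → D(Φ(V,z)) = V`.  An a.e.-on-`O` comparison of the Boltzmann-weighted fibre integrals over `τ` gives
`(D_*(Gibbs_K⌊E))⌊O ≤ ofReal σ • (D_*(Gibbs_K⌊G))⌊O`. [cite: Balaban1987RG1, (2.10) p.267 and (0.13) p.254; Balaban1985UV3, (38)-(41) p.266] -/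
theorem gibbsK_restrict_map_le_of_fibredChartwise {Z : Type*} [MeasurableSpace Z] {τ : Measure Z} [SFinite τ]
    {O : Set (GaugeField (F.P J) 0 (Matrix.specialUnitaryGroup (Fin 2) ℂ))} (hO : IsOpen O)
    {Sfine : Set (GaugeField (F.P K) 0 (Matrix.specialUnitaryGroup (Fin 2) ℂ))}
    {Φ : GaugeField (F.P J) 0 (Matrix.specialUnitaryGroup (Fin 2) ℂ) × Z → GaugeField (F.P K) 0 (Matrix.specialUnitaryGroup (Fin 2) ℂ)}
    {Jc : GaugeField (F.P J) 0 (Matrix.specialUnitaryGroup (Fin 2) ℂ) × Z → ℝ≥0} (hΦ : Measurable Φ) (hJc : Measurable Jc)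
    (hDΦ : ∀ V ∈ O, ∀ z, Jc (V, z) ≠ 0 → descendTo F ℰp J K hJK (Φ (V, z)) = V)
    (hmap : (fieldMeasure (F.P K) 0 (Matrix.specialUnitaryGroup (Fin 2) ℂ)).restrict (descendTo F ℰp J K hJK ⁻¹' O ∩ Sfine) =
      ((((fieldMeasure (F.P J) 0 (Matrix.specialUnitaryGroup (Fin 2) ℂ)).restrict O).prod τ).withDensity (fun p => (Jc p : ℝ≥0∞))).map Φ)
    {E G : Set (GaugeField (F.P K) 0 (Matrix.specialUnitaryGroup (Fin 2) ℂ))} (hE : MeasurableSet E) (hES : E ⊆ Sfine)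
    (hG : MeasurableSet G) (hGS : G ⊆ Sfine) {σ : ℝ}
    (hfib : ∀ᵐ V ∂(fieldMeasure (F.P J) 0 (Matrix.specialUnitaryGroup (Fin 2) ℂ)), V ∈ O →
      ∫⁻ z, E.indicator (fun U => ENNReal.ofReal (boltzmann (F.P K) ((F.scheme ℰp γ).β K) U)) (Φ (V, z)) * (Jc (V, z) : ℝ≥0∞) ∂τ ≤
        ENNReal.ofReal σ * ∫⁻ z, G.indicator (fun U => ENNReal.ofReal (boltzmann (F.P K) ((F.scheme ℰp γ).β K) U)) (Φ (V, z)) * (Jc (V, z) : ℝ≥0∞) ∂τ) :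
    (Measure.map (descendTo F ℰp J K hJK) ((gibbsK F ℰp γ K).restrict E)).restrict O ≤
      ENNReal.ofReal σ • (Measure.map (descendTo F ℰp J K hJK) ((gibbsK F ℰp γ K).restrict G)).restrict O := by
  haveI := isProbabilityMeasure_fieldMeasure (G := Matrix.specialUnitaryGroup (Fin 2) ℂ) (F.P J) 0
  haveI := isProbabilityMeasure_fieldMeasure (G := Matrix.specialUnitaryGroup (Fin 2) ℂ) (F.P K) 0
  have hD : Measurable (descendTo F ℰp J K hJK) := measurable_descendTo F ℰp measurableE_ℰp hJK
  have hw : Measurable fun U : GaugeField (F.P K) 0 (Matrix.specialUnitaryGroup (Fin 2) ℂ) =>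
      ENNReal.ofReal (boltzmann (F.P K) ((F.scheme ℰp γ).β K) U) := (measurable_boltzmann RegularGaugeGroup.measurable_reTr _ _).ennreal_ofReal
  refine restrict_map_le_smul_of_setwise (gibbsK F ℰp γ K) hD hO.measurableSet fun B hB hBO => ?_
  have hset := setwise_of_chartwise hO.measurableSet hD hΦ hJc hDΦ hmap hw hE hES hG hGS hfib B hB hBO
  rw [gibbsK_eq_smul_withDensity]
  simp only [Measure.smul_apply, smul_eq_mul]
  rw [mul_left_comm]
  exact mul_le_mul' le_rfl hset

end AnyFibre

/-! ## §5 (v1.1) The Euclidean presentation: an exact chart of the moderate region on `Ω ⊆ ℝⁿ` gives ✓G's comparison rows (α)(β) with ONE constant `Z` -/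

section Euclidean

variable {n : ℕ} {β' : Type*} [MeasurableSpace β']

/-- ★★ **A FIBRE INTEGRAL WITH AN EXPONENTIAL DENSITY IS `Z ·` THE TILTED LAW**: on a measurable `Ω ⊆ ℝⁿ` of positive volume, if the chart integrand factorises as
`w(Φ z)·Jc z = e^{−U z}` on `Ω` and `Jc = 0` off `Ω`, with `e^{−U}` integrable on `Ω`, then for every measurable `T`
`∫⁻ 1_T(Φ z)·w(Φ z)·Jc z dz = ofReal(Z)·ν(Φ⁻¹T)`, `Z := ∫_Ω e^{−U}`, `ν := (volume.restrict Ω).tilted (−U)` — the law F∕F-BOX∕F-η speak. [folklore] -/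
theorem lintegral_indicator_chart_eq_mul_tilted {Ω : Set (EuclideanSpace ℝ (Fin n))} (hΩ : MeasurableSet Ω) (hΩ0 : volume Ω ≠ 0)
    {Φv : EuclideanSpace ℝ (Fin n) → β'} (hΦv : Measurable Φv) {w : β' → ℝ≥0∞} {Jc : EuclideanSpace ℝ (Fin n) → ℝ≥0}
    {U : EuclideanSpace ℝ (Fin n) → ℝ}
    (hfac : ∀ z ∈ Ω, w (Φv z) * (Jc z : ℝ≥0∞) = ENNReal.ofReal (Real.exp (-U z))) (hoff : ∀ z, z ∉ Ω → Jc z = 0)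
    (hZ : IntegrableOn (fun z => Real.exp (-U z)) Ω) {T : Set β'} (hT : MeasurableSet T) :
    ∫⁻ z, T.indicator w (Φv z) * (Jc z : ℝ≥0∞) ∂volume =
      ENNReal.ofReal (∫ z in Ω, Real.exp (-U z)) * ((volume.restrict Ω).tilted fun z => -U z) (Φv ⁻¹' T) := by
  haveI : NeZero ((volume : Measure (EuclideanSpace ℝ (Fin n))).restrict Ω) := ⟨by rwa [Ne, Measure.restrict_eq_zero]⟩
  have hZpos : 0 < ∫ z in Ω, Real.exp (-U z) := integral_exp_pos hZ
  have hpre : MeasurableSet (Φv ⁻¹' T) := hΦv hT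
  -- the integrand vanishes off `Ω` and equals `1_{Φ⁻¹T}·e^{−U}` on `Ω`
  have hptw : ∀ z, T.indicator w (Φv z) * (Jc z : ℝ≥0∞) = Ω.indicator (fun z => (Φv ⁻¹' T).indicator (fun z => ENNReal.ofReal (Real.exp (-U z))) z) z := by
    intro z
    by_cases hz : z ∈ Ω
    · rw [Set.indicator_of_mem hz]
      by_cases hzT : Φv z ∈ T
      · rw [Set.indicator_of_mem hzT, Set.indicator_of_mem (show z ∈ Φv ⁻¹' T from hzT), hfac z hz]
      · rw [Set.indicator_of_notMem hzT, Set.indicator_of_notMem (show z ∉ Φv ⁻¹' T from hzT), zero_mul]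
    · rw [Set.indicator_of_notMem hz, hoff z hz, ENNReal.coe_zero, mul_zero]
  rw [lintegral_congr hptw, lintegral_indicator hΩ, lintegral_indicator hpre, tilted_apply' _ _ hpre,
    ← lintegral_const_mul' _ _ ENNReal.ofReal_ne_top]
  refine setLIntegral_congr_fun hpre fun z _ => ?_
  rw [← ENNReal.ofReal_mul hZpos.le, mul_div_cancel₀ _ hZpos.ne']

/-- ★★★ **✓G's COMPARISON ROWS (α)(β) FROM AN EXACT EUCLIDEAN CHART OF THE MODERATE REGION, WITH ONE CONSTANT `Z`**: under the factorisation of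
`lintegral_indicator_chart_eq_mul_tilted`, if the chart pulls the bad event into the max-tail event, `Φ⁻¹E ∩ Ω ⊆ {∃ p ∈ s, θ ≤ |Y_p|}`, and pushes the all-small event
into the good one, `{∀ p ∈ s, |Y_p| < θ} ∩ Ω ⊆ Φ⁻¹G`, then with `ν := (volume.restrict Ω).tilted (−U)` and `Z := ofReal ∫_Ω e^{−U}`:
(α) `∫⁻ 1_E(Φ)·w(Φ)·Jc ≤ Z·ofReal(ν.real{∃ p ∈ s, θ ≤ |Y_p|})` and (β) `Z·ofReal(ν.real{∀ p ∈ s, |Y_p| < θ}) ≤ ∫⁻ 1_G(Φ)·w(Φ)·Jc` — the two hypotheses `hα`, `hβ` of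
✓`…TailSupOneComparisonDoor.mass_le_of_subgaussian_comparison` with the SAME `Z` on both sides (the normalisations cancel), (γ) coming from F-BOX on `ν`.
[cite: Balaban1985UV3, (38)-(41) p.266; Balaban1987RG1, (2.10) p.267] -/
theorem comparison_rows_of_euclideanChart {Ω : Set (EuclideanSpace ℝ (Fin n))} (hΩ : MeasurableSet Ω) (hΩ0 : volume Ω ≠ 0)
    {Φv : EuclideanSpace ℝ (Fin n) → β'} (hΦv : Measurable Φv) {w : β' → ℝ≥0∞} {Jc : EuclideanSpace ℝ (Fin n) → ℝ≥0}
    {U : EuclideanSpace ℝ (Fin n) → ℝ}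
    (hfac : ∀ z ∈ Ω, w (Φv z) * (Jc z : ℝ≥0∞) = ENNReal.ofReal (Real.exp (-U z))) (hoff : ∀ z, z ∉ Ω → Jc z = 0)
    (hZ : IntegrableOn (fun z => Real.exp (-U z)) Ω)
    {E G : Set β'} (hE : MeasurableSet E) (hG : MeasurableSet G)
    {A : Type*} (s : Finset A) (obs : A → EuclideanSpace ℝ (Fin n) → ℝ) (θ : ℝ)
    (hEbad : Φv ⁻¹' E ∩ Ω ⊆ {z | ∃ p ∈ s, θ ≤ |obs p z|}) (hGgood : {z | ∀ p ∈ s, |obs p z| < θ} ∩ Ω ⊆ Φv ⁻¹' G) :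
    (∫⁻ z, E.indicator w (Φv z) * (Jc z : ℝ≥0∞) ∂volume ≤
        ENNReal.ofReal (∫ z in Ω, Real.exp (-U z)) *
          ENNReal.ofReal (((volume.restrict Ω).tilted fun z => -U z).real {z | ∃ p ∈ s, θ ≤ |obs p z|})) ∧
    (ENNReal.ofReal (∫ z in Ω, Real.exp (-U z)) *
          ENNReal.ofReal (((volume.restrict Ω).tilted fun z => -U z).real {z | ∀ p ∈ s, |obs p z| < θ}) ≤
        ∫⁻ z, G.indicator w (Φv z) * (Jc z : ℝ≥0∞) ∂volume) := by
  set ν : Measure (EuclideanSpace ℝ (Fin n)) := (volume.restrict Ω).tilted fun z => -U z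
  haveI : IsProbabilityMeasure ν := YMDAG.N14.ConvexFibreBox.isProbabilityMeasure_restrict_tilted hΩ0 hZ
  -- `ν` lives on `Ω`
  have hνΩ : ν Ωᶜ = 0 := by
    have h : ((volume : Measure (EuclideanSpace ℝ (Fin n))).restrict Ω) Ωᶜ = 0 := by
      rw [Measure.restrict_apply hΩ.compl, Set.compl_inter_self, measure_empty]
    exact tilted_absolutelyContinuous _ _ h
  have hcapΩ : ∀ S : Set (EuclideanSpace ℝ (Fin n)), ν S = ν (S ∩ Ω) := by
    intro S
    refine le_antisymm ?_ (measure_mono Set.inter_subset_left)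
    calc ν S ≤ ν (S ∩ Ω ∪ Ωᶜ) := measure_mono fun z hz => by
            by_cases h : z ∈ Ω
            · exact Or.inl ⟨hz, h⟩
            · exact Or.inr h
      _ ≤ ν (S ∩ Ω) + ν Ωᶜ := measure_union_le _ _
      _ = ν (S ∩ Ω) := by rw [hνΩ, add_zero]
  have hreal : ∀ S : Set (EuclideanSpace ℝ (Fin n)), ENNReal.ofReal (ν.real S) = ν S := fun S =>
    by rw [measureReal_def, ENNReal.ofReal_toReal (measure_ne_top ν S)]
  refine ⟨?_, ?_⟩
  · rw [lintegral_indicator_chart_eq_mul_tilted hΩ hΩ0 hΦv hfac hoff hZ hE, hreal]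
    refine mul_le_mul' le_rfl ?_
    calc ν (Φv ⁻¹' E) = ν (Φv ⁻¹' E ∩ Ω) := hcapΩ _
      _ ≤ ν {z | ∃ p ∈ s, θ ≤ |obs p z|} := measure_mono hEbad
  · rw [lintegral_indicator_chart_eq_mul_tilted hΩ hΩ0 hΦv hfac hoff hZ hG, hreal]
    refine mul_le_mul' le_rfl ?_
    calc ν {z | ∀ p ∈ s, |obs p z| < θ} = ν ({z | ∀ p ∈ s, |obs p z| < θ} ∩ Ω) := hcapΩ _
      _ ≤ ν (Φv ⁻¹' G) := measure_mono hGgood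

end Euclidean

end Summit.QuantumFields.YangMills.Theorems.FluctuationComparisonRegPrIntLTailSupOneChartRows

end
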